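import Mathlib
import Summits.Ventures.PercRepro2.SwOutCrossJunctionQAny
import Summits.Ventures.PercRepro2.SwOutCrossJunctionExample2

/-!
# Moving the mark to a dropped vertex, and the any-graph theorem with the mark at a dropped
vertex on an instance (blind cell PercRepro2, night-4 g27, 2026-08-28; proofs/NIGHT4-G27.md §5)

A cross junction whose mark `o` has an outside edge or no edge at all is a cross junction with
the mark at ANY of its dropped vertices (`CrossJunction.toQ`: the dropped vertex's outside edge
comes from `hout`, and the old mark joins the ordinary vertices).  On g25's `crossEx2` (a cross
edge `p₁p₂` and a single dropped vertex `p₃` at one junction — a DISCONNECTED cross graph — the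
old mark `o = 2` with its edge to `l`) the mark may be moved to `p₃ = 6` or to `p₁ = 4`: no
landed junction theorem applies (g25's theorems assume `o ≠ p i`, g26's a connected cross graph);
`sw_of_crossJunctionQ_any` does — **row (SW) holds** (`sw_crossEx2Q_single`, `sw_crossEx2Q_edge`).
-/

namespace Summit.Ventures.PercRepro2

namespace CrossArm

open Hull LocRows

open scoped Classical

section ToQ

variable {V : Type*} {E : Type*} {ends : E → Sym2 V} {X : Type*} {U : Set V} {h u o : V}
  {p : X → V} {G : SimpleGraph X}

/-- **Moving the mark to a dropped vertex**: a cross junction whose mark has an outside edge or no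
edge is a cross junction with the mark at any dropped vertex `p r`. -/
theorem CrossJunction.toQ (hj : CrossJunction ends U h u p G o) (r : X)
    (ho : (∃ e y, ends e = s(o, y) ∧ y ∉ U) ∨ ∀ e, o ∉ ends e) :
    CrossJunctionQ ends U h u p G (p r) r where
  hne_hu := hj.hne_hu
  hne_hp := hj.hne_hp
  hne_up := hj.hne_up
  p_inj := hj.p_inj
  hqr := rfl
  hext_r := by
    rcases hj.hout (p r) (hj.hpU r) (hj.hne_hp r).symm (hj.hop r).symm (hj.hne_up r).symm with
      ⟨e, y, hey, hyU⟩ | h'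
    · exact ⟨e, y, hey, hyU, fun h' => hyU (h' ▸ hj.huU), fun j h' => hyU (h' ▸ hj.hpU j)⟩
    · exfalso
      obtain ⟨e, he⟩ := hj.hup r
      exact h' e (by rw [he]; exact Sym2.mem_mk_right _ _)
  hhU := hj.hhU
  huU := hj.huU
  hpU := hj.hpU
  hloop_h := hj.hloop_h
  hloop_u := hj.hloop_u
  hnadj := hj.hnadj
  hnadj_p := hj.hnadj_p
  hup := hj.hup
  hcross := hj.hcross
  hcross_adj := hj.hcross_adj
  hcross_simple := hj.hcross_simple
  hu_adj_h := hj.hu_adj_h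
  hp_in := hj.hp_in
  hout := fun x hx hxh _ hxu => by
    by_cases hxo : x = o
    · subst hxo
      exact ho
    · exact hj.hout x hx hxh hxo hxu

end ToQ

section Example

/-- `crossEx2` with the mark moved to the single dropped vertex `p₃ = 6`. -/
theorem crossEx2Q_single_junction :
    CrossJunctionQ crossEx2 ({0}ᶜ) 1 3 crossEx2P crossEx2G (crossEx2P (Sum.inr 0)) (Sum.inr 0) :=
  crossEx2_junction.toQ (Sum.inr 0) (Or.inl ⟨10, 0, rfl, by simp⟩)

/-- `crossEx2` with the mark moved to the dropped vertex `p₁ = 4` of the cross edge. -/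
theorem crossEx2Q_edge_junction :
    CrossJunctionQ crossEx2 ({0}ᶜ) 1 3 crossEx2P crossEx2G (crossEx2P (Sum.inl 0)) (Sum.inl 0) :=
  crossEx2_junction.toQ (Sum.inl 0) (Or.inl ⟨10, 0, rfl, by simp⟩)

/-- **Row (SW) on `crossEx2` with the mark at the single dropped vertex `p₃ = 6`** — a
disconnected cross graph with the mark at a dropped vertex, by the any-graph theorem. -/
theorem sw_crossEx2Q_single : Sw crossEx2 0 1 6 := by
  have h := sw_of_crossJunctionQ_any (by decide) crossEx2Q_single_junction
  rwa [crossEx2P_apply.2.2] at h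

/-- **Row (SW) on `crossEx2` with the mark at the dropped vertex `p₁ = 4` of the cross edge.** -/
theorem sw_crossEx2Q_edge : Sw crossEx2 0 1 4 := by
  have h := sw_of_crossJunctionQ_any (by decide) crossEx2Q_edge_junction
  rwa [crossEx2P_apply.1] at h

end Example

end CrossArm

end Summit.Ventures.PercRepro2
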